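import Mathlib
import Summits.Ventures.PercRepro2.TypedHatsAll
import Summits.Ventures.PercRepro2.TypedStarGenCore
import Summits.Ventures.PercRepro2.TypedBundleSpine
import Summits.Ventures.PercRepro2.CutRootsTheorem

-- p2 g5 (2026-08-25): ONE MODULE for the olean lane — the domain of record in one module: TypedResidualFull.lean + TypedBundleFull.lean + TypedBundleCutRoots.lean, p2 g2 / g3.
-- Parts inlined byte for byte (minus their import lines), each in its own section, in olean order: TypedResidualFull, TypedBundleFull; then the closing file TypedBundleCutRoots.lean.

-- ===== inlined TypedResidualFull.lean =====
section TypedResidualFull_part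

/-!
# The domain of record, composed (blind cell PercRepro2, p2 g2, 2026-08-25; sub-claim S1 — the
landing ledger: ASSIGNMENTS v12.62 «the composition on the TypedHatsAll olean»)

Every subtraction of sub-claim S1 in one statement, on the hat landing:

* **`ResidualCoreNHatC := ResidualCoreNHat ∧ ¬ HasRootCut`** — the core with an unmarked typed vertex
  that is not a hat and no root cut at either root; **`HCov_all_of_residualCoreNHatC_all`** —
  UNCONDITIONAL (the hat class by `typedCount_nonneg_of_hats`, the root-cut class by
  `typedCount_nonneg_of_hasRootCut`);
* **`ResidualCoreFull := ResidualCoreNHatC ∧ ¬ OneStar ∧ ¬ OneStarGen`** — in addition, not a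
  one-star of degree `3` (at most one root) nor of degree `≥ 4`; **`HCov_all_of_residualCoreFull_all
  (h3 : StarCerts R) (h4 : StarCertsGen R)`** — CONDITIONAL on the two `K₅` certificate bundles (explicit
  hypotheses, never facts); what remains has at least two unmarked typed vertices, or one unmarked
  typed vertex adjacent to an unmarked vertex.

Own code; standard axioms.
-/

namespace Summit.Ventures.PercRepro2

open UnionCluster

namespace CovForm

namespace TypedRed

section Core

variable {V : Type*} {E : Type*} [DecidableEq V] [Fintype E] [DecidableEq E]

/-- **The hat landing with the root-cut class subtracted.** -/
structure ResidualCoreNHatC (ends : E → Sym2 V) (o a₁ a₂ a₃ b : V) (F : Finset E) : Prop where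
  coreNHat : ResidualCoreNHat ends o a₁ a₂ a₃ b F
  no_cut : ¬ HasRootCut ends o a₁ a₂ a₃ b F

/-- **Every subtraction of S1**: the hat landing, no root cut, no one-star of any degree. -/
structure ResidualCoreFull (ends : E → Sym2 V) (o a₁ a₂ a₃ b : V) (F : Finset E) : Prop where
  coreNHatC : ResidualCoreNHatC ends o a₁ a₂ a₃ b F
  not_oneStar : ¬ OneStar ends o a₁ a₂ a₃ b F
  not_oneStarGen : ¬ OneStarGen ends o a₁ a₂ a₃ b F

end Core

section Closure

variable (R : Type*) [Field R] [LinearOrder R] [IsStrictOrderedRing R]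

/-- **Row 2′TRI on `ResidualCoreNHatC`, over every finite graph.** -/
def ResidualCoreNHatC_all : Prop :=
  ∀ (V E : Type) [Fintype V] [DecidableEq V] [Fintype E] [DecidableEq E]
    (ends : E → Sym2 V) (o a₁ a₂ a₃ b : V) (F : Finset E) (τ : E → ℕ),
    (∀ e ∈ F, τ e = 1 ∨ τ e = 2) → ResidualCoreNHatC ends o a₁ a₂ a₃ b F →
      0 ≤ typedCount F (fun _ => false) τ
        (K3 ends o a₁ a₂ a₃ b : Config E → Config E → Config E → R)

/-- **Row 2′TRI on `ResidualCoreFull`, over every finite graph.** -/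
def ResidualCoreFull_all : Prop :=
  ∀ (V E : Type) [Fintype V] [DecidableEq V] [Fintype E] [DecidableEq E]
    (ends : E → Sym2 V) (o a₁ a₂ a₃ b : V) (F : Finset E) (τ : E → ℕ),
    (∀ e ∈ F, τ e = 1 ∨ τ e = 2) → ResidualCoreFull ends o a₁ a₂ a₃ b F →
      0 ≤ typedCount F (fun _ => false) τ
        (K3 ends o a₁ a₂ a₃ b : Config E → Config E → Config E → R)

/-- **THE CRUX OF RECORD FROM (TRI) ON THE HAT LANDING WITHOUT A ROOT CUT** — unconditional. -/
theorem HCov_all_of_residualCoreNHatC_all (hc : ResidualCoreNHatC_all R) : HCov_all R := by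
  refine HCov_all_of_residualCoreNHat_all R ?_
  intro V E _ _ _ _ ends o a₁ a₂ a₃ b F τ hτ hcore
  by_cases hcut : HasRootCut ends o a₁ a₂ a₃ b F
  · exact typedCount_nonneg_of_hasRootCut ends o a₁ a₂ a₃ b F τ hτ hcut
  · exact hc V E ends o a₁ a₂ a₃ b F τ hτ ⟨hcore, hcut⟩

/-- **CONDITIONAL on the two certificate bundles: the crux of record from (TRI) on the full residual
core** — the hat landing without a root cut and without a one-star of any degree. -/
theorem HCov_all_of_residualCoreFull_all (h3 : StarCerts R) (h4 : StarCertsGen R)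
    (hc : ResidualCoreFull_all R) : HCov_all R := by
  refine HCov_all_of_residualCoreNHatC_all R ?_
  intro V E _ _ _ _ ends o a₁ a₂ a₃ b F τ hτ hcore
  have hred := hcore.coreNHat.core.residualConR.residualCon.residual.reduced
  by_cases hs : OneStar ends o a₁ a₂ a₃ b F
  · exact typedCount_nonneg_of_oneStar h3 ends o a₁ a₂ a₃ b F τ hτ hcore.coreNHat.core.marks
      hred.no_loop hred.no_parallel hs
  by_cases hg : OneStarGen ends o a₁ a₂ a₃ b F
  · exact typedCount_nonneg_of_oneStarGen h4 ends o a₁ a₂ a₃ b F τ hτ hcore.coreNHat.core.marks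
      hred.no_loop hred.no_parallel hg
  · exact hc V E ends o a₁ a₂ a₃ b F τ hτ ⟨hcore, hs, hg⟩

end Closure

end TypedRed

end CovForm

end Summit.Ventures.PercRepro2

end TypedResidualFull_part

-- ===== inlined TypedBundleFull.lean =====
section TypedBundleFull_part

/-!
# The two-terminal and root-bundle rules composed with every subtraction of S1 (blind cell
PercRepro2, p2 g3, 2026-08-25)

`ResidualCoreNHatCTB` = the hat landing without a root cut, without a two-terminal part and
without a root bundle (unconditional: `HCov_all_of_residualCoreNHatCTB_all`) — the domain of
record; `ResidualCoreFullTB` = the same without a one-star of any degree (conditional on the two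
certificate bundles). In the domain of record no unmarked vertex is a hat, no unmarked part hangs
on the root pair and one more vertex, no unmarked part is attached at only two vertices.
-/

namespace Summit.Ventures.PercRepro2

open UnionCluster

namespace CovForm

namespace TypedRed

section Core

variable {V : Type*} {E : Type*} [DecidableEq V] [Fintype E] [DecidableEq E]

/-- **The hat landing without a root cut, a two-terminal part or a root bundle.** -/
structure ResidualCoreNHatCTB (ends : E → Sym2 V) (o a₁ a₂ a₃ b : V) (F : Finset E) : Prop where
  coreNHatC : ResidualCoreNHatC ends o a₁ a₂ a₃ b F
  no_twoTerminal : ¬ HasTwoTerminalPart ends o a₁ a₂ a₃ b F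
  no_rootBundle : ¬ HasRootBundle ends o a₁ a₂ a₃ b F

/-- **Every subtraction of S1 together with the two-terminal and root-bundle rules.** -/
structure ResidualCoreFullTB (ends : E → Sym2 V) (o a₁ a₂ a₃ b : V) (F : Finset E) : Prop where
  coreFull : ResidualCoreFull ends o a₁ a₂ a₃ b F
  no_twoTerminal : ¬ HasTwoTerminalPart ends o a₁ a₂ a₃ b F
  no_rootBundle : ¬ HasRootBundle ends o a₁ a₂ a₃ b F

end Core

section Closure

variable (R : Type*) [Field R] [LinearOrder R] [IsStrictOrderedRing R]

/-- **Row 2′TRI on `ResidualCoreNHatCTB`, over every finite graph.** -/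
def ResidualCoreNHatCTB_all : Prop :=
  ∀ (V E : Type) [Fintype V] [DecidableEq V] [Fintype E] [DecidableEq E]
    (ends : E → Sym2 V) (o a₁ a₂ a₃ b : V) (F : Finset E) (τ : E → ℕ),
    (∀ e ∈ F, τ e = 1 ∨ τ e = 2) → ResidualCoreNHatCTB ends o a₁ a₂ a₃ b F →
      0 ≤ typedCount F (fun _ => false) τ
        (K3 ends o a₁ a₂ a₃ b : Config E → Config E → Config E → R)

/-- **Row 2′TRI on `ResidualCoreFullTB`, over every finite graph.** -/
def ResidualCoreFullTB_all : Prop :=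
  ∀ (V E : Type) [Fintype V] [DecidableEq V] [Fintype E] [DecidableEq E]
    (ends : E → Sym2 V) (o a₁ a₂ a₃ b : V) (F : Finset E) (τ : E → ℕ),
    (∀ e ∈ F, τ e = 1 ∨ τ e = 2) → ResidualCoreFullTB ends o a₁ a₂ a₃ b F →
      0 ≤ typedCount F (fun _ => false) τ
        (K3 ends o a₁ a₂ a₃ b : Config E → Config E → Config E → R)

/-- **THE CRUX OF RECORD FROM (TRI) ON THE HAT LANDING WITHOUT A ROOT CUT, A TWO-TERMINAL PART OR
A ROOT BUNDLE** — unconditional. -/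
theorem HCov_all_of_residualCoreNHatCTB_all (hc : ResidualCoreNHatCTB_all R) : HCov_all R := by
  refine HCov_all_of_residualCoreTB_all R ?_
  intro V E _ _ _ _ ends o a₁ a₂ a₃ b F τ hτ hcore
  by_cases hh : Hats ends o a₁ a₂ a₃ b F
  · exact typedCount_nonneg_of_hats F ends o a₁ a₂ a₃ b τ hcore.core.marks
      hcore.core.residualConR.residualCon.residual.reduced.no_loop (fun e he _ => hτ e he) hh
  by_cases hcut : HasRootCut ends o a₁ a₂ a₃ b F
  · exact typedCount_nonneg_of_hasRootCut ends o a₁ a₂ a₃ b F τ hτ hcut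
  · exact hc V E ends o a₁ a₂ a₃ b F τ hτ
      ⟨⟨⟨hcore.core, hh⟩, hcut⟩, hcore.no_twoTerminal, hcore.no_rootBundle⟩

/-- **CONDITIONAL on the two certificate bundles: the crux of record from (TRI) on the full core
without a two-terminal part or a root bundle.** -/
theorem HCov_all_of_residualCoreFullTB_all (h3 : StarCerts R) (h4 : StarCertsGen R)
    (hc : ResidualCoreFullTB_all R) : HCov_all R := by
  refine HCov_all_of_residualCoreNHatCTB_all R ?_
  intro V E _ _ _ _ ends o a₁ a₂ a₃ b F τ hτ hcore
  have hred := hcore.coreNHatC.coreNHat.core.residualConR.residualCon.residual.reduced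
  by_cases hs : OneStar ends o a₁ a₂ a₃ b F
  · exact typedCount_nonneg_of_oneStar h3 ends o a₁ a₂ a₃ b F τ hτ
      hcore.coreNHatC.coreNHat.core.marks hred.no_loop hred.no_parallel hs
  by_cases hg : OneStarGen ends o a₁ a₂ a₃ b F
  · exact typedCount_nonneg_of_oneStarGen h4 ends o a₁ a₂ a₃ b F τ hτ
      hcore.coreNHatC.coreNHat.core.marks hred.no_loop hred.no_parallel hg
  · exact hc V E ends o a₁ a₂ a₃ b F τ hτ
      ⟨⟨hcore.coreNHatC, hs, hg⟩, hcore.no_twoTerminal, hcore.no_rootBundle⟩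

end Closure

end TypedRed

end CovForm

end Summit.Ventures.PercRepro2

end TypedBundleFull_part

-- ===== TARGET TypedBundleCutRoots.lean =====

/-!
# The domain of record with p3's cut-roots class subtracted (blind cell PercRepro2, p2 g3,
2026-08-25; p3 g3's `typedCount_nonneg_of_hasCutRoots`, INBOX 11:38Z)

`ResidualCoreNHatCTBR` = the hat landing without a root cut, a two-terminal part, a root bundle or
an unmarked cut vertex separating the roots from `{o, b, a₃}` (`RootBridge.HasCutRoots`);
**`HCov_all_of_residualCoreNHatCTBR_all`** is unconditional once CutRootsTheorem lands — p3's class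
is a direct theorem of its instance and composes like the hat and root-cut classes.
-/

namespace Summit.Ventures.PercRepro2

open UnionCluster

namespace CovForm

namespace TypedRed

section Core

variable {V : Type*} {E : Type*} [DecidableEq V] [Fintype E] [DecidableEq E]

/-- **The domain of record without the cut-roots class.** -/
structure ResidualCoreNHatCTBR (ends : E → Sym2 V) (o a₁ a₂ a₃ b : V) (F : Finset E) : Prop where
  coreNHatCTB : ResidualCoreNHatCTB ends o a₁ a₂ a₃ b F
  no_cutRoots : ¬ RootBridge.HasCutRoots ends o a₁ a₂ a₃ b F

end Core

section Closure

variable (R : Type*) [Field R] [LinearOrder R] [IsStrictOrderedRing R]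

/-- **Row 2′TRI on `ResidualCoreNHatCTBR`, over every finite graph.** -/
def ResidualCoreNHatCTBR_all : Prop :=
  ∀ (V E : Type) [Fintype V] [DecidableEq V] [Fintype E] [DecidableEq E]
    (ends : E → Sym2 V) (o a₁ a₂ a₃ b : V) (F : Finset E) (τ : E → ℕ),
    (∀ e ∈ F, τ e = 1 ∨ τ e = 2) → ResidualCoreNHatCTBR ends o a₁ a₂ a₃ b F →
      0 ≤ typedCount F (fun _ => false) τ
        (K3 ends o a₁ a₂ a₃ b : Config E → Config E → Config E → R)

/-- **THE CRUX OF RECORD FROM (TRI) ON THE DOMAIN OF RECORD WITHOUT THE CUT-ROOTS CLASS** —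
unconditional (on p3's theorem). -/
theorem HCov_all_of_residualCoreNHatCTBR_all (hc : ResidualCoreNHatCTBR_all R) : HCov_all R := by
  refine HCov_all_of_residualCoreNHatCTB_all R ?_
  intro V E _ _ _ _ ends o a₁ a₂ a₃ b F τ hτ hcore
  by_cases hr : RootBridge.HasCutRoots ends o a₁ a₂ a₃ b F
  · exact RootBridge.typedCount_nonneg_of_hasCutRoots ends o a₁ a₂ a₃ b F τ hτ hr
  · exact hc V E ends o a₁ a₂ a₃ b F τ hτ ⟨hcore, hr⟩

end Closure

end TypedRed

end CovForm

end Summit.Ventures.PercRepro2
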